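import Literature.MathematicalPhysics.QuantumFieldTheory.Balaban1983to89.Node00.U3KernelLetters

/-!
# NODE 00 ∕ W1 — ONE MORE NAMED LETTER FOR NODE U3's KERNEL INPUTS: the UNIFORM windowed (5.10) decay
# (ONE constant `E₀` over the whole window, every level, every direction pair), generic and at the record, with its faces and estimate-free transfers

Seat `pub-ymgap-node00-def-W1` g31 (DEFINER; Literature side, hypothesis-schema style, D-0064), APPEND-ONLY sibling of `Node00/U3KernelLetters` (W1-19b):
nothing of W1-19b is renamed, re-homed or re-declared; this file imports it and adds ONE letter family.  Consumer shape VERBATIM: the displayed hypothesis `hKu`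
of the Summit-side junction `YMDAG.N18.KernelLettersJunctions.decayBound_EA_of_windowedUniform` ∕ `…scaleShiftRate_betaMergedOfRecord_of_letters` (seat
`pub-ymgap-dag-n18-w1`, node N18's (J2) «N18 letter + a UNIFORM windowed (5.10) decay ⟹ node N17's scale-shift rate of the merged β»).

## Why

W1-19b's `WindowedDecay F ℰ ρ bV W μ ν κ` carries ONE constant PER coupling sequence `g ∈ W` (`∀ g ∈ W, ∃ C₀, …`).  Node U3's own output-side decay slot
`T4OutputRate.DecayBound (EA …) W E₀ κ` ([I] (1.18) p. 263 read on the limiting kernels) and node N17's kernel road need ONE constant `E₀` for ALL `g ∈ W`, all levels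
`k` and all direction pairs `(μ, ν)` — the per-sequence letter does NOT serve them (said in the consumer's file).  This file names that uniform form:

* §1 (generic, over a term family `ℰ : Node00.TermFamily1 F 𝔄`, a probe `ρ`, a basis `bV`, a window `W`):
  - `WindowedDecayUniform F ℰ ρ bV W E₀ δ` — `|Π^{(K)}_{k+1,μν}(g; z)| ≤ E₀ e^{−δ|z|₁}` EVENTUALLY in the volume index `K`, for every `g ∈ W`, `k`, `μ ν`, `z`, with ONE `E₀`
    (the consumer's `hKu` verbatim); its `Iff.rfl` face; the projection `WindowedDecayUniform.windowedDecay` onto W1-19b's per-sequence letter (take `C₀ := E₀`);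
    monotonicity in the window and in the constant; and the ESTIMATE-FREE TRANSFER `windowedDecayUniform_iff_of_eventuallyAgree` under W1-20's
    `LocalizedSum17.EventuallyAgree F ℰ ℰ'` (the windowed kernel sequences are eventually equal — W1-19b's `polWindow_eventuallyEq_of_eventuallyAgree` — so the
    letter transfers by `Filter.eventually_congr`; no convergence used or claimed).
* §2 (at the record, Stage 13): the edition `WindowedDecayUniformOfRecord₁₃ F N θ E₀ δ` at the MERGED TERM FAMILY OF RECORD
  `mergedTermFamilyMatT F N (TβOfRecord₁₃ F N) (chiβOfRecord₁₃ F N θ) θ.εbg` in the record's β-chart `θ.ρ8 ∕ θ.bV` (instances bound by `letI` exactly as in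
  `U3OfKernels.objectsOfRecord₁₃` and in every W1-19b letter of record) on the window `]0, θ.γ]^ℕ`; its `Iff.rfl` face, whose right-hand side IS the raw hypothesis
  `hKu` of `scaleShiftRate_betaMergedOfRecord_of_letters`; the projection onto `WindowedDecayOfRecord₁₃`; and the READING-SIDE face
  `windowedDecayUniformOfRecord₁₃_iff_of_localizes`: under W1-20's law `Localizes17OfRecord₁₃ F N θ S emb` the letter of record ⟺ the same letter at the W1
  reading's localized sum `localizedSum F S emb` ([II] (2.13)–(2.14)).

## HONEST LIMITS

A binder (`Prop`-valued definition), `Iff.rfl` faces, two monotonicity one-liners and filter-congruence bookkeeping ONLY.  The letter is NOT inhabited here; the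
passage «uniform windowed decay + (1.21)-existence ⟹ `DecayBound (EA …) W E₀ δ`» (`le_of_tendsto`) is the Summit side's (`decayBound_EA_of_windowedUniform`), not
typed here; no estimate of print is proved or asserted — the uniform windowed (5.10) bound is the CONTENT of [I] §5 ((5.10) p. 293, constants uniform in `k` by
Thm 1 p. 259) carried through the cluster expansion at finite volume, NOT PRINTED in this windowed finite-volume form.  Count-neutral; no node of the record is
discharged; no inhabitant of the record is claimed; one finite-torus programme at fixed lattice spacing — nothing continuum, nothing about a mass gap.

## CITATION HEADER (D-0065)
- [I] = T. Bałaban, Renormalization group approach to lattice gauge field theories. I., Comm. Math. Phys. 109 (1987) 249–301 [Balaban1987RG1]: Thm 1 p. 259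
  (constants uniform in k); (1.18) p. 263; (1.20)–(1.21) p. 264; (5.10) p. 293.
- [II] = T. Bałaban, Renormalization group approach to lattice gauge field theories. II. Cluster expansions, Comm. Math. Phys. 116 (1988) 1–22
  [Balaban1988RG2Cluster]: (2.13)–(2.14) pp. 14–15 (the terms whose localized sum W1-20 types; the reading-side face of §2).

Typer lint: no `instance`, no `notation`, no attribute removal, no `sorry`; imports `Node00.U3KernelLetters` only; nothing re-declared (`polWindow ∕ histPrefix ∕
WindowedDecay ∕ WindowedDecayOfRecord₁₃ ∕ polWindow_eventuallyEq_of_eventuallyAgree ∕ EventuallyAgree ∕ Localizes17OfRecord₁₃ ∕ localizedSum` cited by name).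
-/

open scoped BigOperators

namespace Literature.MathematicalPhysics.QuantumFieldTheory.Balaban1983to89.Node00.U3KernelLetters2

open Filter
open T4Continuum (T4Family)
open T4OutputRate (Window)
open B12Sec2to5 (l1)
open U3OfKernels (histPrefix)
open LocalizedSum17 (EventuallyAgree localizedSum ReadingMaps Localizes17OfRecord₁₃)
open U3KernelLetters (WindowedDecay WindowedDecayOfRecord₁₃ polWindow_eventuallyEq_of_eventuallyAgree)
open W1 (ClusterTower)

/-! ## §1. The uniform windowed (5.10) decay letter, generic over a term family -/

section Generic

variable {𝔄 : Type*} [NormedRing 𝔄] [NormedAlgebra ℝ 𝔄]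
variable {V : Type*} [NormedAddCommGroup V] [NormedSpace ℝ V] {ι : Type*} [Fintype ι]
variable (F : T4Family) (ℰ : TermFamily1 F 𝔄) (ρ : V →L[ℝ] 𝔄) (bV : Module.Basis ι ℝ V)

/-- **UNIFORM WINDOWED (5.10) DECAY** (binder): `|Π^{(K)}_{k+1,μν}(g; z)| ≤ E₀ e^{−δ|z|₁}` EVENTUALLY in the volume index `K`, for EVERY coupling sequence `g` of
the window `W`, every level `k`, every direction pair `(μ, ν)` and every separation `z`, with ONE constant `E₀` — the uniform form node U3's decay slot and node
N17's kernel road consume (W1-19b's `WindowedDecay` has one constant per sequence).  NOT PRINTED in this windowed finite-volume form; a displayed hypothesis of the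
kernel producers. [cite: Balaban1987RG1, (5.10) p.293, Thm 1 p.259 and (1.20) p.264] -/
def WindowedDecayUniform (W : Set (ℕ → ℝ)) (E₀ δ : ℝ) : Prop :=
  ∀ g ∈ W, ∀ (k : ℕ) (μ ν : Fin 4) (z : Fin 4 → ℤ), ∀ᶠ K in atTop,
    |polWindow F K (k + 1) (ℰ k (histPrefix g k) K) ρ bV μ ν z| ≤ E₀ * Real.exp (-δ * l1 z)

/-- Face (`Iff.rfl`): the letter IS the raw uniform windowed (5.10) hypothesis `hKu` of the Summit-side (J2) junction.
[cite: Balaban1987RG1, (5.10) p.293 (bookkeeping)] -/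
theorem windowedDecayUniform_iff (W : Set (ℕ → ℝ)) (E₀ δ : ℝ) :
    WindowedDecayUniform F ℰ ρ bV W E₀ δ ↔
      ∀ g ∈ W, ∀ (k : ℕ) (μ ν : Fin 4) (z : Fin 4 → ℤ), ∀ᶠ K in atTop,
        |polWindow F K (k + 1) (ℰ k (histPrefix g k) K) ρ bV μ ν z| ≤ E₀ * Real.exp (-δ * l1 z) := Iff.rfl

variable {ℰ}

/-- The uniform letter gives W1-19b's per-sequence letter in every direction pair (take `C₀ := E₀`). [cite: Balaban1987RG1, (5.10) p.293 (bookkeeping)] -/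
theorem WindowedDecayUniform.windowedDecay {W : Set (ℕ → ℝ)} {E₀ δ : ℝ} (h : WindowedDecayUniform F ℰ ρ bV W E₀ δ) (μ ν : Fin 4) :
    WindowedDecay F ℰ ρ bV W μ ν δ := fun g hg => ⟨E₀, fun k z => h g hg k μ ν z⟩

/-- Monotonicity in the window: the letter restricts to a smaller window. [cite: Balaban1987RG1, (5.10) p.293 (bookkeeping)] -/
theorem WindowedDecayUniform.anti {W W' : Set (ℕ → ℝ)} {E₀ δ : ℝ} (h : WindowedDecayUniform F ℰ ρ bV W E₀ δ) (hW : W' ⊆ W) :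
    WindowedDecayUniform F ℰ ρ bV W' E₀ δ := fun g hg => h g (hW hg)

/-- Monotonicity in the constant: a larger `E₀' ≥ E₀` also bounds. [cite: Balaban1987RG1, (5.10) p.293 (bookkeeping)] -/
theorem WindowedDecayUniform.mono {W : Set (ℕ → ℝ)} {E₀ E₀' δ : ℝ} (h : WindowedDecayUniform F ℰ ρ bV W E₀ δ) (hE : E₀ ≤ E₀') :
    WindowedDecayUniform F ℰ ρ bV W E₀' δ := fun g hg k μ ν z => by
  filter_upwards [h g hg k μ ν z] with K hK
  exact hK.trans (mul_le_mul_of_nonneg_right hE (Real.exp_pos _).le)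

/-- `WindowedDecayUniform` transfers between eventually-agreeing term families (`Filter.eventually_congr` on W1-19b's
`polWindow_eventuallyEq_of_eventuallyAgree`; no convergence claimed). [cite: Balaban1987RG1, (5.10) p.293 and (1.20) p.264 (bookkeeping)] -/
theorem windowedDecayUniform_iff_of_eventuallyAgree {ℰ ℰ' : TermFamily1 F 𝔄} (h : EventuallyAgree F ℰ ℰ') (W : Set (ℕ → ℝ)) (E₀ δ : ℝ) :
    WindowedDecayUniform F ℰ ρ bV W E₀ δ ↔ WindowedDecayUniform F ℰ' ρ bV W E₀ δ := by
  refine forall₂_congr fun g _ => forall_congr' fun k => forall₂_congr fun μ ν => forall_congr' fun z => ?_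
  refine Filter.eventually_congr ?_
  filter_upwards [polWindow_eventuallyEq_of_eventuallyAgree F ρ bV h g k μ ν z] with K hK
  rw [hK]

end Generic

/-! ## §2. The letter at the record, Stage 13, and its reading-side face -/

section Record

open scoped Matrix.Norms.L2Operator

variable (F : T4Family) (N : ℕ) [NeZero N] {𝔸 : Type*} {M : ℕ}

/-- **UNIFORM WINDOWED (5.10) DECAY OF RECORD** with constant `E₀` and rate `δ` (binder; free parameters), for the merged term family of record in the record's
β-chart on the window `]0, θ.γ]^ℕ`. [cite: Balaban1987RG1, (5.10) p.293, Thm 1 p.259 and (1.20) p.264] -/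
def WindowedDecayUniformOfRecord₁₃ (θ : Stage13Params F N) (E₀ δ : ℝ) : Prop :=
  letI := θ.instVβ₁; letI := θ.instVβ₂; letI := θ.instιβ
  WindowedDecayUniform F (mergedTermFamilyMatT F N (TβOfRecord₁₃ F N) (chiβOfRecord₁₃ F N θ) θ.εbg) θ.ρ8 θ.bV (Window θ.γ) E₀ δ

/-- Face (`Iff.rfl`): the letter IS the raw uniform windowed (5.10) hypothesis `hKu` the Summit-side (J2) junction displays at the merged term of record
(`YMDAG.N18.KernelLettersJunctions.scaleShiftRate_betaMergedOfRecord_of_letters`). [cite: Balaban1987RG1, (5.10) p.293 (bookkeeping)] -/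
theorem windowedDecayUniformOfRecord₁₃_iff (θ : Stage13Params F N) (E₀ δ : ℝ) :
    WindowedDecayUniformOfRecord₁₃ F N θ E₀ δ ↔
      (letI := θ.instVβ₁; letI := θ.instVβ₂; letI := θ.instιβ
       ∀ g ∈ Window θ.γ, ∀ (k : ℕ) (μ ν : Fin 4) (z : Fin 4 → ℤ), ∀ᶠ K in atTop,
        |polWindow F K (k + 1)
            (mergedTermFamilyMatT F N (TβOfRecord₁₃ F N) (chiβOfRecord₁₃ F N θ) θ.εbg k (histPrefix g k) K) θ.ρ8 θ.bV μ ν z| ≤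
          E₀ * Real.exp (-δ * l1 z)) :=
  Iff.rfl

variable {N}

/-- The uniform letter of record gives W1-19b's per-sequence letter of record in every direction pair (`C₀ := E₀`).
[cite: Balaban1987RG1, (5.10) p.293 (bookkeeping)] -/
theorem WindowedDecayUniformOfRecord₁₃.windowedDecayOfRecord₁₃ {θ : Stage13Params F N} {E₀ δ : ℝ} (h : WindowedDecayUniformOfRecord₁₃ F N θ E₀ δ)
    (μ ν : Fin 4) : WindowedDecayOfRecord₁₃ F N θ μ ν δ := by
  letI := θ.instVβ₁; letI := θ.instVβ₂; letI := θ.instιβ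
  exact WindowedDecayUniform.windowedDecay F θ.ρ8 θ.bV h μ ν

/-- Monotonicity of the letter of record in the constant. [cite: Balaban1987RG1, (5.10) p.293 (bookkeeping)] -/
theorem WindowedDecayUniformOfRecord₁₃.mono {θ : Stage13Params F N} {E₀ E₀' δ : ℝ} (h : WindowedDecayUniformOfRecord₁₃ F N θ E₀ δ) (hE : E₀ ≤ E₀') :
    WindowedDecayUniformOfRecord₁₃ F N θ E₀' δ := by
  letI := θ.instVβ₁; letI := θ.instVβ₂; letI := θ.instιβ
  exact WindowedDecayUniform.mono F θ.ρ8 θ.bV h hE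

variable (N)

/-- READING SIDE: under W1-20's law at the record, the uniform windowed (5.10) decay of record ⟺ the same letter for the W1 reading's localized sum.
[cite: Balaban1987RG1, (1.7) p.261 and (5.10) p.293; Balaban1988RG2Cluster, (2.14) p.15] -/
theorem windowedDecayUniformOfRecord₁₃_iff_of_localizes (θ : Stage13Params F N) (S : (K : ℕ) → ClusterTower (F.P K) 𝔸 M)
    (emb : ReadingMaps F (MatA N) 𝔸) (h : Localizes17OfRecord₁₃ F N θ S emb) (E₀ δ : ℝ) :
    WindowedDecayUniformOfRecord₁₃ F N θ E₀ δ ↔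
      (letI := θ.instVβ₁; letI := θ.instVβ₂; letI := θ.instιβ
       WindowedDecayUniform F (localizedSum F S emb) θ.ρ8 θ.bV (Window θ.γ) E₀ δ) := by
  letI := θ.instVβ₁; letI := θ.instVβ₂; letI := θ.instιβ
  exact windowedDecayUniform_iff_of_eventuallyAgree F θ.ρ8 θ.bV (h.eventuallyAgree F) (Window θ.γ) E₀ δ

end Record

end Literature.MathematicalPhysics.QuantumFieldTheory.Balaban1983to89.Node00.U3KernelLetters2
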